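import Summits.ResolutionOfSingularities.ResolutionOfSingularities.Theorems.FrobeniusClosingPatchingRelPerfectDepthOneTargetsDefs
import Summits.ResolutionOfSingularities.ResolutionOfSingularities.Theorems.FrobeniusClosingPatchingRelPerfectDepthOneDictionaryStep
import HarnessLib

/-!
# Crux `PatchingRelPerfect` (stmt-ResolutionOfSingularities-16161), chain w52 — programme r-d1,
# piece D1 BY NAME: `DepthOneTargets.DictionaryStep` holds

[OURS · L1 W5.2 · rung tool] The typed target `DepthOneTargets.DictionaryStep` of plan-1's targets E
(`…DepthOneTargetsDefs.lean`) is closed by repackaging the by-content theorem `dictionaryStep`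
(`…DepthOneDictionaryStep.lean`, p495681): the eight fields of `DepthOneInvariant` are fed in order and
collected in order. Nothing here is a statement of the manuscript under review.
-/

-- `Summit.<Summit>.<Sub>.Theorems` with `Sub = Summit` (single-conjunct summit, D-0017)
set_option linter.dupNamespace false

noncomputable section

open CategoryTheory AlgebraicGeometry

namespace Summit.ResolutionOfSingularities.ResolutionOfSingularities.Theorems

universe u

/-- **D1 by name**: plan-1's typed target `DepthOneTargets.DictionaryStep` (one controlled step on the
exceptional threefold is matched by one blowing up of the ambient scheme preserving `DepthOneInvariant`)
holds — from `dictionaryStep`. [cite: GortzWedhorn2020, Prop. 13.91 (1), Prop. 13.96 (2)] -/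
theorem dictionaryStep_holds : DepthOneTargets.DictionaryStep.{u} := by
  intro S _ _ I E X i g 𝔟 h E' τ C 𝔟' hC hle hτ hctrl
  obtain ⟨X', i', g', h1, h2, h3, h4, h5, h6, h7, h8⟩ := dictionaryStep I i g 𝔟 h.isNoetherian
    h.isRegular h.isRegular_exc h.isClosedImmersion h.isEffectiveCartier_ker h.map_eq_closedPoint
    h.exists_isBlowup_supported h.exists_format τ C 𝔟' hC hle hτ hctrl
  exact ⟨X', i', g', ⟨h1, h2, h3, h4, h5, h6, h7, h8⟩⟩

end Summit.ResolutionOfSingularities.ResolutionOfSingularities.Theorems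

end
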